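import Summits.QuantumFields.YangMills.Theorems.BalabanUVNodesN21GappedTopCut13CoPH

/-!
# N21 (NE7c) · THE GAPPED TOP CUT — THE TWO-SIDED PIGEONHOLE: the sum over the top histories under the unity law ON THE GRAPH, the collar count along a geometric grid of
# letters (`Σ_{i<m} collar(θ_{i+2}, θ_i) ≤ 2·#cubes`), hence `Σ_{i<m} Σ_{s′} gapShell_i(s′) ≤ 2(2L^m)⁴ · Σ_s classWeight_k(s)` and ONE COMMON DEPTH for two runs — (M1)-FREE,
# at NODE 00's generality `ϑ D g₀ os p g k`

R134 seat `pub-ymgap-dag-n21-d` (g11), node N21 = NE7c (NOT PRINTED; NOT proved at print's fixed thresholds), strategy s2; lane K3⁷ `SpineGivenEndpointR13SepCoPH`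
(stmt-QuantumFields-20544, `--supports … --as helper`; COUNT-NEUTRAL).  Imports `…N21GappedTopCut13CoPH` (§29–§31: the resummed two-sided cover and the graph identities) and,
through it, the definition lane `…GappedTopCut13CoPHDefs`, T1∕T2 (`cutGrid`, `isStepUnity_wTopAt`), S2 (`argmin_badness_bounds`), g9's COUNT (`card_cubeIndices_top_le` as
`card_Iχ_top_le`), R3's `cutGrid_succ_le`.  Sequel (the two runs OF RECORD on the live line): `…N21GappedTopCut13CoPHRecord`.

WHAT THIS FILE PROVES (theorems only; 0 `def`, 0 `sorry`; [folklore] finite sums + the tree's unity law BY NAME).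
* §32 ★★ `sum_topGapShellAt_le_integral_collar` — at the top `k + 1 = p.K`, for `θlo ≤ θ ≤ θhi`: `Σ_{s′} gapShell^{θlo,θ,θhi}(s′) ≤ ∫ collar(θlo,θhi)(Ū) · ρ̃_k(U) dU` with
  `ρ̃_k = Σ_s χ_k(s)·slot_k(s)` the record's level-`k` dressed density: §31's graph bound summed over the fibres of `init` and the unity law of the top-lettered step weights ON
  THE GRAPH (`isStepUnity_wTopAt`) — the sum over the top histories of `χ^{θ}(s′)(Ū)·wTop^{θ}(s′)(U,Ū)` is `1` against `χ_k(s)(U)`.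
* §33 `sum_range_sub_shift_two` (telescoping in steps of two), ★ `sum_range_collarAt_cutGrid_le` — along the grid `θ_i = ε_{k+1}(1 − ρ)^i` the collars `[θ_{i+2}, θ_i)` at the
  depths `i < m` count every χ_{k+1}-cube at most TWICE: `Σ_{i<m} collar(θ_{i+2}, θ_i)(V′) ≤ 2·#cubes` (each cube's indicator lies in `[0,1]`; NO sign hypothesis needed here).
* §34 ★★★ `sum_range_sum_topGapShell_le` — in the meaningful regime `0 ≤ ε_{k+1}`, `0 ≤ ρ ≤ 1` (antitone grid, so `θ_{i+2} ≤ θ_{i+1} ≤ θ_i`), under `0 ≤ ζ`, `Σ|ζ| ≤ 1`, `Σζ = 1`,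
  (H-ζ) and F3's (e1) at level `k`: `Σ_{i<m} Σ_{s′} gapShell(θ_{i+2}, θ_{i+1}, θ_i)(s′) ≤ 2(2L^m)⁴ · Σ_s classWeight_k(s)`; ★★★ `exists_depth_topGapShell_le` (one run: some `i ≤ n`
  has `Σ_{s′} gapShell_i ≤ (2(2L^m)⁴∕(n+1))·Σ_s classWeight_k`); ★★★ `exists_common_depth_topGapShell_le` (TWO runs of the same tuple, ONE depth `i ≤ n` with
  `Σ_{s′} gapShell_i ≤ (4(2L^m)⁴∕(n+1))·Σ_s classWeight` in EACH — S2's `argmin_badness_bounds`).  NO anti-concentration, NO estimate of Bałaban's.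

HONEST FRAMING (binding).  [folklore] bookkeeping over NODE 00's objects of record; NO estimate of Bałaban's; only the top step's (2.17)∕(3.2) family is re-lettered (the (3.3)
family and everything below the top are print's ∕ the record's — LOCATED); the common-refinement inequality of design (i) («common shell ≤ gapped shell», needs the two-run site
identification and N16's sup-closeness `Δ_K ≤` both gaps `θ_{i+1}ρ`, `θ_iρ`) is the CONSUMER's; no lettered spine READING typed here; no `Provisos` inhabitant claimed (K0⁷ open);
NE7c NOT PRINTED ∕ NOT proved at print's thresholds; N21 NOT discharged; K3⁷ NOT claimed; counts UNMOVED (typed 28∕28 · discharged 5∕27); never a count claim.  No `instance`,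
no `notation`, no `def`.  One finite four-torus programme at fixed `ε` — NOT ℝ⁴, NOT OS, NOT a mass gap, NOT the Clay problem.
-/

noncomputable section

open scoped BigOperators
open Finset MeasureTheory

namespace Summit.QuantumFields.YangMills.Theorems.N21ShellSplitOfRecord13CoPH

open Literature.MathematicalPhysics.QuantumFieldTheory.Balaban1983to89
open Literature.MathematicalPhysics.QuantumFieldTheory.Balaban1983to89.T4Continuum
open Literature.MathematicalPhysics.QuantumFieldTheory.Balaban1983to89.Node00
open Summit.QuantumFields.YangMills.BalabanUVNodes.N19MGFRoadLiveSelectorTower (dressedSlotsOfDatum₉_nonneg)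
open Summit.QuantumFields.YangMills.BalabanUVNodes.N19MGFFormAtRecord (wOfRecord₉_nonneg)

/-! ## §32 The sum over the top histories: unity ON THE GRAPH -/

section SumHistories

variable (F : T4Family) (N : ℕ) [NeZero N] (ϑ : Stage9Params F N) (D : FiniteEpsData F (SU N)) (g₀ : ℕ → ℝ) (os : List (ULoop F))
  (p : B12.RunParams) (g : ℕ → ℝ) (k : ℕ)

/-- ★★ **THE SUM OF THE TWO-SIDED COLLAR SHELLS OVER THE TOP HISTORIES**: at the top `k + 1 = p.K`, for `θlo ≤ θ ≤ θhi`,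
`Σ_{s′} gapShell^{θlo,θ,θhi}(s′) ≤ ∫ collar(θlo,θhi)(Ū) · Σ_s χ_k(s)(U)·slot_k^{t}(s)(U) dU` — §31's graph bound, the fibres of `init`, and the unity law of the top-lettered
step weights on the graph (`isStepUnity_wTopAt`: `χ_k(s)(U)·Σ_{init s′ = s} χ^{θ}(s′)(Ū)·wTop^{θ}(s′)(U,Ū) = χ_k(s)(U)`).  Rows: `0 ≤ ζ`, `Σ|ζ| ≤ 1`, `Σζ = 1`, (H-ζ), (e1) at level `k`.
[bookkeeping] -/
theorem sum_topGapShellAt_le_integral_collar (hk : k + 1 = p.K) (hζ0 : ∀ p g k s Pl Ql RS U V', 0 ≤ ϑ.ζ p g k s Pl Ql RS U V') (hζm : ZetaMeasurable F N ϑ.ζ)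
    (hζ1 : IsZetaAbsLeOne F N ϑ.ν ϑ.τ9.M ϑ.ζ) (hζu : IsZetaUnity F N ϑ.ν ϑ.τ9.M ϑ.ζ) {θlo θ θhi : ℝ} (hlo : θlo ≤ θ) (hhi : θ ≤ θhi) (t : ℝ)
    (hint : ∀ s : SeqOfRecord F ϑ.ν ϑ.τ9.M g p.K k,
      Integrable (fun U => chiSeqOfRecord F N ϑ.ν ϑ.τ9.M g p.K k s U * dressedSlotsOfDatum₉ F N ϑ D g₀ os t p g k s U) (fieldMeasure (F.P p.K) k (SU N))) :
    ∑ s', topGapShellAt F N ϑ D g₀ os p g k θlo θ θhi t s' ≤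
      ∫ U, collarAt F N ϑ.ν p g k θlo θhi ((avOfRecord F N p.K k).avg U) *
        ∑ s, chiSeqOfRecord F N ϑ.ν ϑ.τ9.M g p.K k s U * dressedSlotsOfDatum₉ F N ϑ D g₀ os t p g k s U ∂fieldMeasure (F.P p.K) k (SU N) := by
  classical
  have hk' : k < p.K := by omega
  have hU : LocalBgMeasurable F N ϑ.ν := localBgMeasurable F N ϑ.ν
  set avg := (avOfRecord F N p.K k).avg with havg
  -- the graph integrands and their integrability
  set G : SeqOfRecord F ϑ.ν ϑ.τ9.M g p.K (k + 1) → GaugeField (F.P p.K) k (SU N) → ℝ := fun s' U =>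
    (chiSeqOfRecord F N ϑ.ν ϑ.τ9.M g p.K k s'.init U * dressedSlotsOfDatum₉ F N ϑ D g₀ os t p g k s'.init U) *
      (collarAt F N ϑ.ν p g k θlo θhi (avg U) *
        (chiSeqOfRecordAt F N ϑ.ν ϑ.τ9.M g p.K (k + 1) θ s' (avg U) * wTopAt F N ϑ θ p g k s' U (avg U))) with hG
  have hGint : ∀ s', Integrable (G s') (fieldMeasure (F.P p.K) k (SU N)) := fun s' =>
    integrable_oldPiece_mul_graph F N ϑ D g₀ os p g k t hint s'
      (b := fun z => collarAt F N ϑ.ν p g k θlo θhi z.1 *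
        (chiSeqOfRecordAt F N ϑ.ν ϑ.τ9.M g p.K (k + 1) θ s' z.1 * wTopAt F N ϑ θ p g k s' z.2 z.1))
      (((measurable_collarAt F N ϑ.ν p g k θlo θhi).comp measurable_fst).mul
        ((((measurable_chiSeqOfRecordAt_of_localBg hU ϑ.τ9.M g p.K (k + 1) θ s').comp measurable_fst).mul (measurable_wTopAt F N ϑ p g k hζm θ s'))))
      (C := Fintype.card (Iχ F ϑ.ν p g k)) (fun z => by
        rw [Real.norm_eq_abs, abs_mul, abs_mul]
        calc |collarAt F N ϑ.ν p g k θlo θhi z.1| * (|chiSeqOfRecordAt F N ϑ.ν ϑ.τ9.M g p.K (k + 1) θ s' z.1| * |wTopAt F N ϑ θ p g k s' z.2 z.1|)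
            ≤ (Fintype.card (Iχ F ϑ.ν p g k) : ℝ) * (1 * 1) :=
              mul_le_mul (abs_collarAt_le_card F N ϑ.ν p g k θlo θhi z.1)
                (mul_le_mul (abs_chiSeqOfRecordAt_le_one F N ϑ.ν ϑ.τ9.M g p.K (k + 1) θ s' z.1) (abs_wTopAt_le_one F N ϑ p g k hζ1 θ s' z.2 z.1)
                  (abs_nonneg _) zero_le_one)
                (mul_nonneg (abs_nonneg _) (abs_nonneg _)) (Nat.cast_nonneg _)
          _ = Fintype.card (Iχ F ϑ.ν p g k) := by ring)
  -- the unity law of the top-lettered step weights on the graph, at the letters of the top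
  have hunit := isStepUnity_wTopAt F N ϑ p g k hζu θ
  have hlow := chiSeqOfRecordAt_topLetter_of_lt F N ϑ p g k hk' θ
  have htop : topLetter ϑ.ν θ p g (k + 1) = θ := by rw [hk]; exact topLetter_top ϑ.ν θ p g
  rw [hlow, htop] at hunit
  -- pointwise identity on the old field space
  have hpt : ∀ U, ∑ s', G s' U = collarAt F N ϑ.ν p g k θlo θhi (avg U) *
      ∑ s, chiSeqOfRecord F N ϑ.ν ϑ.τ9.M g p.K k s U * dressedSlotsOfDatum₉ F N ϑ D g₀ os t p g k s U := by
    intro U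
    rw [B14.Eq218Concrete.Seq.sum_seq_succ_fiber, Finset.mul_sum]
    refine Finset.sum_congr rfl fun s _ => ?_
    have hu := hunit s U
    calc ∑ s' ∈ Finset.univ.filter (fun s' : SeqOfRecord F ϑ.ν ϑ.τ9.M g p.K (k + 1) => s'.init = s), G s' U
        = ∑ s' ∈ Finset.univ.filter (fun s' : SeqOfRecord F ϑ.ν ϑ.τ9.M g p.K (k + 1) => s'.init = s),
            (collarAt F N ϑ.ν p g k θlo θhi (avg U) * dressedSlotsOfDatum₉ F N ϑ D g₀ os t p g k s U) *
              (chiSeqOfRecord F N ϑ.ν ϑ.τ9.M g p.K k s U *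
                (chiSeqOfRecordAt F N ϑ.ν ϑ.τ9.M g p.K (k + 1) θ s' (avg U) * wTopAt F N ϑ θ p g k s' U (avg U))) := by
          refine Finset.sum_congr rfl fun s' hs' => ?_
          rw [hG]
          simp only
          rw [(Finset.mem_filter.1 hs').2]
          ring
      _ = (collarAt F N ϑ.ν p g k θlo θhi (avg U) * dressedSlotsOfDatum₉ F N ϑ D g₀ os t p g k s U) * chiSeqOfRecord F N ϑ.ν ϑ.τ9.M g p.K k s U := by
          rw [← Finset.mul_sum, ← Finset.mul_sum, hu]
      _ = collarAt F N ϑ.ν p g k θlo θhi (avg U) * (chiSeqOfRecord F N ϑ.ν ϑ.τ9.M g p.K k s U * dressedSlotsOfDatum₉ F N ϑ D g₀ os t p g k s U) := by ring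
  calc ∑ s', topGapShellAt F N ϑ D g₀ os p g k θlo θ θhi t s'
      ≤ ∑ s', ∫ U, G s' U ∂fieldMeasure (F.P p.K) k (SU N) :=
        Finset.sum_le_sum fun s' _ => topGapShellAt_le_graph_collar F N ϑ D g₀ os p g k hk hζ0 hζm hζ1 hlo hhi t hint s'
    _ = ∫ U, ∑ s', G s' U ∂fieldMeasure (F.P p.K) k (SU N) := (integral_finsetSum _ fun s' _ => hGint s').symm
    _ = _ := integral_congr_ae (ae_of_all _ hpt)

end SumHistories

/-! ## §33 The collar count along a geometric grid of letters -/

section CollarCount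

variable (F : T4Family) (N : ℕ) [NeZero N] (ν : Stage7Numerics) (p : B12.RunParams) (g : ℕ → ℝ) (k : ℕ)

variable {F N p g k} in
/-- one step down the grid does not go up, in the meaningful regime `0 ≤ ε`, `0 ≤ ρ ≤ 1`: `θ_{i+1} = θ_i(1 − ρ) ≤ θ_i` (R3's `cutGrid_succ_le`, restated to keep this
file's imports light). [bookkeeping] -/
theorem cutGrid_succ_le_of_nonneg (j : ℕ) (hε : 0 ≤ epsOfRecord ν g j) {ρ : ℝ} (hρ0 : 0 ≤ ρ) (hρ1 : ρ ≤ 1) (i : ℕ) :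
    cutGrid ν g j ρ (i + 1) ≤ cutGrid ν g j ρ i := by
  unfold cutGrid
  rw [pow_succ, ← mul_assoc]
  exact mul_le_of_le_one_right (mul_nonneg hε (pow_nonneg (by linarith) i)) (by linarith)

variable {F N ν p g k} in
/-- **TELESCOPING IN STEPS OF TWO**: `Σ_{i<m} (x_i − x_{i+2}) = x_0 + x_1 − x_m − x_{m+1}`. [folklore] -/
theorem sum_range_sub_shift_two (x : ℕ → ℝ) (m : ℕ) : ∑ i ∈ Finset.range m, (x i - x (i + 2)) = x 0 + x 1 - x m - x (m + 1) := by
  induction m with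
  | zero => simp
  | succ m ih => rw [Finset.sum_range_succ, ih]; ring

variable {F N ν p g k} in
/-- a `[0,1]`-valued sequence has `Σ_{i<m} (x_i − x_{i+2}) ≤ 2`. [folklore] -/
theorem sum_range_sub_shift_two_le_two {x : ℕ → ℝ} (h0 : ∀ i, 0 ≤ x i) (h1 : ∀ i, x i ≤ 1) (m : ℕ) :
    ∑ i ∈ Finset.range m, (x i - x (i + 2)) ≤ 2 := by
  rw [sum_range_sub_shift_two]
  linarith [h1 0, h1 1, h0 m, h0 (m + 1)]

/-- ★ **ALONG THE GRID `θ_i = ε_{k+1}(1 − ρ)^i` THE COLLARS `[θ_{i+2}, θ_i)`, `i < m`, COUNT EVERY χ_{k+1}-CUBE AT MOST TWICE**: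
`Σ_{i<m} collar(θ_{i+2}, θ_i)(V′) ≤ 2 · #cubes` (swap the sums; each cube's (2.17) indicator lies in `[0,1]`, §33's telescoping). NO sign hypothesis. [bookkeeping] -/
theorem sum_range_collarAt_cutGrid_le (ρ : ℝ) (m : ℕ) (V' : GaugeField (F.P p.K) (k + 1) (SU N)) :
    ∑ i ∈ Finset.range m, collarAt F N ν p g k (cutGrid ν g (k + 1) ρ (i + 2)) (cutGrid ν g (k + 1) ρ i) V' ≤ 2 * Fintype.card (Iχ F ν p g k) := by
  unfold collarAt
  rw [Finset.sum_comm]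
  calc ∑ c : Iχ F ν p g k, ∑ i ∈ Finset.range m,
        (chiFactorAt F N ν p g k (cutGrid ν g (k + 1) ρ i) c V' - chiFactorAt F N ν p g k (cutGrid ν g (k + 1) ρ (i + 2)) c V')
      ≤ ∑ _c : Iχ F ν p g k, (2 : ℝ) := Finset.sum_le_sum fun c _ =>
          sum_range_sub_shift_two_le_two (x := fun i => chiFactorAt F N ν p g k (cutGrid ν g (k + 1) ρ i) c V')
            (fun i => chiFactorAt_nonneg F N ν p g k _ c V') (fun i => chiFactorAt_le_one F N ν p g k _ c V') m
    _ = 2 * Fintype.card (Iχ F ν p g k) := by rw [Finset.sum_const, nsmul_eq_mul, Finset.card_univ, mul_comm]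

end CollarCount

/-! ## §34 The two-sided pigeonhole at the top-lettered terms and the common depth of two runs — (M1)-FREE -/

section Pigeonhole

variable (F : T4Family) (N : ℕ) [NeZero N] (ϑ : Stage9Params F N) (D : FiniteEpsData F (SU N)) (g₀ : ℕ → ℝ) (os : List (ULoop F))

/-- ★★★ **THE TWO-SIDED PIGEONHOLE WITH g9's COUNT**: along the grid `θ_i = ε_{k+1}(1 − ρ)^i` in the meaningful regime `0 ≤ ε_{k+1}`, `0 ≤ ρ ≤ 1`, at the run's top
`k + 1 = p.K`, under `0 ≤ ζ`, `Σ|ζ| ≤ 1`, `Σζ = 1`, (H-ζ) and F3's (e1) integrability at level `k`: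
`Σ_{i<m} Σ_{s′} gapShell(θ_{i+2}, θ_{i+1}, θ_i)(s′) ≤ 2(2L^m)⁴ · Σ_s classWeight_k(s)` — §32 per depth, §33's collar count, `#cubes ≤ (2L^m)⁴`.  NO anti-concentration,
NO estimate of Bałaban's. [bookkeeping] -/
theorem sum_range_sum_topGapShell_le (p : B12.RunParams) (g : ℕ → ℝ) (k : ℕ) (hk : k + 1 = p.K)
    (hζ0 : ∀ p g k s Pl Ql RS U V', 0 ≤ ϑ.ζ p g k s Pl Ql RS U V') (hζm : ZetaMeasurable F N ϑ.ζ) (hζ1 : IsZetaAbsLeOne F N ϑ.ν ϑ.τ9.M ϑ.ζ)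
    (hζu : IsZetaUnity F N ϑ.ν ϑ.τ9.M ϑ.ζ) (hε : 0 ≤ epsOfRecord ϑ.ν g (k + 1)) {ρ : ℝ} (hρ0 : 0 ≤ ρ) (hρ1 : ρ ≤ 1) (m : ℕ) (t : ℝ)
    (hint : ∀ s : SeqOfRecord F ϑ.ν ϑ.τ9.M g p.K k,
      Integrable (fun U => chiSeqOfRecord F N ϑ.ν ϑ.τ9.M g p.K k s U * dressedSlotsOfDatum₉ F N ϑ D g₀ os t p g k s U) (fieldMeasure (F.P p.K) k (SU N))) :
    ∑ i ∈ Finset.range m, ∑ s', topGapShellAt F N ϑ D g₀ os p g k (cutGrid ϑ.ν g (k + 1) ρ (i + 2)) (cutGrid ϑ.ν g (k + 1) ρ (i + 1))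
        (cutGrid ϑ.ν g (k + 1) ρ i) t s' ≤
      2 * (2 * (F.L : ℝ) ^ F.m) ^ 4 * ∑ s, classWeightOfDatum₉ F N ϑ D g₀ os p g k t s := by
  set avg := (avOfRecord F N p.K k).avg with havg
  set old : GaugeField (F.P p.K) k (SU N) → ℝ := fun U =>
    ∑ s, chiSeqOfRecord F N ϑ.ν ϑ.τ9.M g p.K k s U * dressedSlotsOfDatum₉ F N ϑ D g₀ os t p g k s U with hold
  set B : ℕ → GaugeField (F.P p.K) (k + 1) (SU N) → ℝ := fun i V' =>
    collarAt F N ϑ.ν p g k (cutGrid ϑ.ν g (k + 1) ρ (i + 2)) (cutGrid ϑ.ν g (k + 1) ρ i) V' with hB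
  set C : ℝ := (Fintype.card (Iχ F ϑ.ν p g k) : ℝ) with hC
  have hold0 : ∀ U, 0 ≤ old U := fun U => Finset.sum_nonneg fun s _ => mul_nonneg (chiSeqOfRecord_nonneg F N ϑ.ν ϑ.τ9.M g p.K k s U)
    (dressedSlotsOfDatum₉_nonneg F N ϑ D g₀ os p g (wOfRecord₉_nonneg ϑ hζ0 p g) t k s U)
  have holdint : Integrable old (fieldMeasure (F.P p.K) k (SU N)) := integrable_finsetSum _ fun s _ => hint s
  have hstep : ∀ i, cutGrid ϑ.ν g (k + 1) ρ (i + 1) ≤ cutGrid ϑ.ν g (k + 1) ρ i := fun i => cutGrid_succ_le_of_nonneg ϑ.ν (k + 1) hε hρ0 hρ1 i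
  have hBm : ∀ i, Measurable (B i) := fun i => measurable_collarAt F N ϑ.ν p g k _ _
  have hBabs : ∀ i V', |B i V'| ≤ C := fun i V' => abs_collarAt_le_card F N ϑ.ν p g k _ _ V'
  have holdB : ∀ i, Integrable (fun U => B i (avg U) * old U) (fieldMeasure (F.P p.K) k (SU N)) := fun i =>
    (holdint.bdd_mul ((hBm i).comp (avOfRecord_measurable F N p.K k)).aestronglyMeasurable
      (ae_of_all _ fun U => by rw [Real.norm_eq_abs]; exact hBabs i (avg U)))
  -- per depth: §32
  have hdepth : ∀ i, ∑ s', topGapShellAt F N ϑ D g₀ os p g k (cutGrid ϑ.ν g (k + 1) ρ (i + 2)) (cutGrid ϑ.ν g (k + 1) ρ (i + 1))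
      (cutGrid ϑ.ν g (k + 1) ρ i) t s' ≤ ∫ U, B i (avg U) * old U ∂fieldMeasure (F.P p.K) k (SU N) := fun i =>
    sum_topGapShellAt_le_integral_collar F N ϑ D g₀ os p g k hk hζ0 hζm hζ1 hζu (hstep (i + 1)) (hstep i) t hint
  -- the count
  have hsumB : ∀ V', ∑ i ∈ Finset.range m, B i V' ≤ 2 * C := fun V' => sum_range_collarAt_cutGrid_le F N ϑ.ν p g k ρ m V'
  have hC4 : C ≤ (2 * (F.L : ℝ) ^ F.m) ^ 4 := card_Iχ_top_le F ϑ.ν p g k hk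
  have hZ : ∫ U, old U ∂fieldMeasure (F.P p.K) k (SU N) = ∑ s, classWeightOfDatum₉ F N ϑ D g₀ os p g k t s := by
    rw [hold, integral_finsetSum _ fun s _ => hint s]
    rfl
  have hZ0 : 0 ≤ ∑ s, classWeightOfDatum₉ F N ϑ D g₀ os p g k t s := by rw [← hZ]; exact integral_nonneg hold0
  calc ∑ i ∈ Finset.range m, ∑ s', topGapShellAt F N ϑ D g₀ os p g k (cutGrid ϑ.ν g (k + 1) ρ (i + 2)) (cutGrid ϑ.ν g (k + 1) ρ (i + 1))
          (cutGrid ϑ.ν g (k + 1) ρ i) t s'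
      ≤ ∑ i ∈ Finset.range m, ∫ U, B i (avg U) * old U ∂fieldMeasure (F.P p.K) k (SU N) := Finset.sum_le_sum fun i _ => hdepth i
    _ = ∫ U, (∑ i ∈ Finset.range m, B i (avg U)) * old U ∂fieldMeasure (F.P p.K) k (SU N) := by
        rw [← integral_finsetSum _ fun i _ => holdB i]
        refine integral_congr_ae (ae_of_all _ fun U => ?_)
        simp only [Finset.sum_mul]
    _ ≤ ∫ U, (2 * C) * old U ∂fieldMeasure (F.P p.K) k (SU N) := by
        refine integral_mono_of_nonneg (ae_of_all _ fun U => mul_nonneg (Finset.sum_nonneg fun i _ =>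
            collarAt_nonneg F N ϑ.ν p g k ((hstep (i + 1)).trans (hstep i)) (avg U)) (hold0 U))
          (holdint.const_mul (2 * C)) (ae_of_all _ fun U => mul_le_mul_of_nonneg_right (hsumB (avg U)) (hold0 U))
    _ = (2 * C) * ∑ s, classWeightOfDatum₉ F N ϑ D g₀ os p g k t s := by rw [integral_const_mul, hZ]
    _ ≤ 2 * (2 * (F.L : ℝ) ^ F.m) ^ 4 * ∑ s, classWeightOfDatum₉ F N ϑ D g₀ os p g k t s :=
        mul_le_mul_of_nonneg_right (by linarith) hZ0

/-- ★★★ **ONE RUN: SOME DEPTH CARRIES A LIGHT TWO-SIDED COLLAR** — for every `n`, some `i ≤ n` has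
`Σ_{s′} gapShell(θ_{i+2}, θ_{i+1}, θ_i)(s′) ≤ (2(2L^m)⁴∕(n+1)) · Σ_s classWeight_k(s)` (the minimum is below the mean). [bookkeeping] -/
theorem exists_depth_topGapShell_le (p : B12.RunParams) (g : ℕ → ℝ) (k : ℕ) (hk : k + 1 = p.K)
    (hζ0 : ∀ p g k s Pl Ql RS U V', 0 ≤ ϑ.ζ p g k s Pl Ql RS U V') (hζm : ZetaMeasurable F N ϑ.ζ) (hζ1 : IsZetaAbsLeOne F N ϑ.ν ϑ.τ9.M ϑ.ζ)
    (hζu : IsZetaUnity F N ϑ.ν ϑ.τ9.M ϑ.ζ) (hε : 0 ≤ epsOfRecord ϑ.ν g (k + 1)) {ρ : ℝ} (hρ0 : 0 ≤ ρ) (hρ1 : ρ ≤ 1) (n : ℕ) (t : ℝ)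
    (hint : ∀ s : SeqOfRecord F ϑ.ν ϑ.τ9.M g p.K k,
      Integrable (fun U => chiSeqOfRecord F N ϑ.ν ϑ.τ9.M g p.K k s U * dressedSlotsOfDatum₉ F N ϑ D g₀ os t p g k s U) (fieldMeasure (F.P p.K) k (SU N))) :
    ∃ i ∈ Finset.range (n + 1), ∑ s', topGapShellAt F N ϑ D g₀ os p g k (cutGrid ϑ.ν g (k + 1) ρ (i + 2)) (cutGrid ϑ.ν g (k + 1) ρ (i + 1))
        (cutGrid ϑ.ν g (k + 1) ρ i) t s' ≤
      2 * (2 * (F.L : ℝ) ^ F.m) ^ 4 / (n + 1 : ℕ) * ∑ s, classWeightOfDatum₉ F N ϑ D g₀ os p g k t s := by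
  have h := sum_range_sum_topGapShell_le F N ϑ D g₀ os p g k hk hζ0 hζm hζ1 hζu hε hρ0 hρ1 (n + 1) t hint
  refine Finset.exists_le_of_sum_le ⟨0, Finset.mem_range.2 (Nat.succ_pos n)⟩ (h.trans (le_of_eq ?_))
  rw [Finset.sum_const, Finset.card_range, nsmul_eq_mul]
  have hn : ((n + 1 : ℕ) : ℝ) ≠ 0 := by positivity
  field_simp

/-- ★★★ **TWO RUNS OF THE SAME TUPLE, ONE COMMON DEPTH** (run 1 at its top `k₁ + 1 = p₁.K`, run 2 at `k₂ + 1 = p₂.K`; one width `ρ ∈ [0,1]`, one depth budget `n`, one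
source `t`; both tops' `ε ≥ 0`): some `i ≤ n` has BOTH `Σ_{s′} gapShell¹(θ¹_{i+2}, θ¹_{i+1}, θ¹_i) ≤ (4(2L^m)⁴∕(n+1))·Σ_s classWeight¹_{k₁}(s)` AND the same for run 2 — S2's argmin of
the normalised two-run shell mass.  The two runs then read their top (2.17)∕(3.2) factors at the COMMON relative letter `(1 − ρ)^{i+1}` below each run's own `ε`, with the
open collar `((1 − ρ)^{i+2}, (1 − ρ)^{i})` EMPTY of top cube statistics on the cores — the single-run half of `T4IndicatorShell`'s design (i), (M1)-FREE. [bookkeeping] -/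
theorem exists_common_depth_topGapShell_le (p₁ : B12.RunParams) (g₁ : ℕ → ℝ) (k₁ : ℕ) (hk₁ : k₁ + 1 = p₁.K) (p₂ : B12.RunParams) (g₂ : ℕ → ℝ) (k₂ : ℕ)
    (hk₂ : k₂ + 1 = p₂.K)
    (hζ0 : ∀ p g k s Pl Ql RS U V', 0 ≤ ϑ.ζ p g k s Pl Ql RS U V') (hζm : ZetaMeasurable F N ϑ.ζ) (hζ1 : IsZetaAbsLeOne F N ϑ.ν ϑ.τ9.M ϑ.ζ)
    (hζu : IsZetaUnity F N ϑ.ν ϑ.τ9.M ϑ.ζ) (hε₁ : 0 ≤ epsOfRecord ϑ.ν g₁ (k₁ + 1)) (hε₂ : 0 ≤ epsOfRecord ϑ.ν g₂ (k₂ + 1)) {ρ : ℝ} (hρ0 : 0 ≤ ρ) (hρ1 : ρ ≤ 1)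
    (n : ℕ) (t : ℝ)
    (hint₁ : ∀ s : SeqOfRecord F ϑ.ν ϑ.τ9.M g₁ p₁.K k₁,
      Integrable (fun U => chiSeqOfRecord F N ϑ.ν ϑ.τ9.M g₁ p₁.K k₁ s U * dressedSlotsOfDatum₉ F N ϑ D g₀ os t p₁ g₁ k₁ s U) (fieldMeasure (F.P p₁.K) k₁ (SU N)))
    (hint₂ : ∀ s : SeqOfRecord F ϑ.ν ϑ.τ9.M g₂ p₂.K k₂,
      Integrable (fun U => chiSeqOfRecord F N ϑ.ν ϑ.τ9.M g₂ p₂.K k₂ s U * dressedSlotsOfDatum₉ F N ϑ D g₀ os t p₂ g₂ k₂ s U) (fieldMeasure (F.P p₂.K) k₂ (SU N))) :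
    ∃ i ∈ Finset.range (n + 1),
      ∑ s', topGapShellAt F N ϑ D g₀ os p₁ g₁ k₁ (cutGrid ϑ.ν g₁ (k₁ + 1) ρ (i + 2)) (cutGrid ϑ.ν g₁ (k₁ + 1) ρ (i + 1)) (cutGrid ϑ.ν g₁ (k₁ + 1) ρ i) t s' ≤
          4 * (2 * (F.L : ℝ) ^ F.m) ^ 4 / (n + 1 : ℕ) * ∑ s, classWeightOfDatum₉ F N ϑ D g₀ os p₁ g₁ k₁ t s ∧
        ∑ s', topGapShellAt F N ϑ D g₀ os p₂ g₂ k₂ (cutGrid ϑ.ν g₂ (k₂ + 1) ρ (i + 2)) (cutGrid ϑ.ν g₂ (k₂ + 1) ρ (i + 1)) (cutGrid ϑ.ν g₂ (k₂ + 1) ρ i) t s' ≤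
          4 * (2 * (F.L : ℝ) ^ F.m) ^ 4 / (n + 1 : ℕ) * ∑ s, classWeightOfDatum₉ F N ϑ D g₀ os p₂ g₂ k₂ t s := by
  set f : ℕ → ℝ := fun i => ∑ s', topGapShellAt F N ϑ D g₀ os p₁ g₁ k₁ (cutGrid ϑ.ν g₁ (k₁ + 1) ρ (i + 2)) (cutGrid ϑ.ν g₁ (k₁ + 1) ρ (i + 1))
    (cutGrid ϑ.ν g₁ (k₁ + 1) ρ i) t s' with hf
  set f' : ℕ → ℝ := fun i => ∑ s', topGapShellAt F N ϑ D g₀ os p₂ g₂ k₂ (cutGrid ϑ.ν g₂ (k₂ + 1) ρ (i + 2)) (cutGrid ϑ.ν g₂ (k₂ + 1) ρ (i + 1))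
    (cutGrid ϑ.ν g₂ (k₂ + 1) ρ i) t s' with hf'
  set S₁ : ℝ := ∑ s, classWeightOfDatum₉ F N ϑ D g₀ os p₁ g₁ k₁ t s with hS₁
  set S₂ : ℝ := ∑ s, classWeightOfDatum₉ F N ϑ D g₀ os p₂ g₂ k₂ t s with hS₂
  have hstep₁ : ∀ i, cutGrid ϑ.ν g₁ (k₁ + 1) ρ (i + 1) ≤ cutGrid ϑ.ν g₁ (k₁ + 1) ρ i := fun i => cutGrid_succ_le_of_nonneg ϑ.ν (k₁ + 1) hε₁ hρ0 hρ1 i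
  have hstep₂ : ∀ i, cutGrid ϑ.ν g₂ (k₂ + 1) ρ (i + 1) ≤ cutGrid ϑ.ν g₂ (k₂ + 1) ρ i := fun i => cutGrid_succ_le_of_nonneg ϑ.ν (k₂ + 1) hε₂ hρ0 hρ1 i
  have hf0 : ∀ i, 0 ≤ f i := fun i => Finset.sum_nonneg fun s' _ =>
    topGapShellAt_nonneg F N ϑ D g₀ os p₁ g₁ k₁ hk₁ hζ0 hζm hζ1 (hstep₁ (i + 1)) (hstep₁ i) t hint₁ s'
  have hf'0 : ∀ i, 0 ≤ f' i := fun i => Finset.sum_nonneg fun s' _ =>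
    topGapShellAt_nonneg F N ϑ D g₀ os p₂ g₂ k₂ hk₂ hζ0 hζm hζ1 (hstep₂ (i + 1)) (hstep₂ i) t hint₂ s'
  have hw₁ : ∀ k s' U V', 0 ≤ wOfRecord₉ F N ϑ p₁ g₁ k s' U V' := wOfRecord₉_nonneg ϑ hζ0 p₁ g₁
  have hw₂ : ∀ k s' U V', 0 ≤ wOfRecord₉ F N ϑ p₂ g₂ k s' U V' := wOfRecord₉_nonneg ϑ hζ0 p₂ g₂
  have hS₁0 : 0 ≤ S₁ := Finset.sum_nonneg fun s _ => classWeightOfDatum₉_nonneg' F N ϑ D g₀ os p₁ g₁ k₁ hw₁ t s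
  have hS₂0 : 0 ≤ S₂ := Finset.sum_nonneg fun s _ => classWeightOfDatum₉_nonneg' F N ϑ D g₀ os p₂ g₂ k₂ hw₂ t s
  have hsum₁ : ∑ i ∈ Finset.range (n + 1), f i ≤ 2 * (2 * (F.L : ℝ) ^ F.m) ^ 4 * S₁ :=
    sum_range_sum_topGapShell_le F N ϑ D g₀ os p₁ g₁ k₁ hk₁ hζ0 hζm hζ1 hζu hε₁ hρ0 hρ1 (n + 1) t hint₁
  have hsum₂ : ∑ i ∈ Finset.range (n + 1), f' i ≤ 2 * (2 * (F.L : ℝ) ^ F.m) ^ 4 * S₂ :=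
    sum_range_sum_topGapShell_le F N ϑ D g₀ os p₂ g₂ k₂ hk₂ hζ0 hζm hζ1 hζu hε₂ hρ0 hρ1 (n + 1) t hint₂
  obtain ⟨i₀, hi₀, hmin⟩ := (Finset.range (n + 1)).exists_min_image (fun i => f i / S₁ + f' i / S₂) ⟨0, by simp⟩
  obtain ⟨h₁, h₂⟩ := argmin_badness_bounds hf0 hf'0 hS₁0 hS₂0 (by positivity) hsum₁ hsum₂ hi₀ hmin
  refine ⟨i₀, hi₀, ?_, ?_⟩
  · refine h₁.trans (le_of_eq ?_); ring
  · refine h₂.trans (le_of_eq ?_); ring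

end Pigeonhole

end Summit.QuantumFields.YangMills.Theorems.N21ShellSplitOfRecord13CoPH

end
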